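import Mathlib
import Summits.KontsevichZagierPeriods.Zeta5Search.BrickPropositionHInf
import Summits.KontsevichZagierPeriods.Zeta5Search.BrickDenominators

/-!
# BrickPropositionHDepth — PROPOSITION H^∞ AT EVERY LAURENT DEPTH (odd `p`): the weighted digit induction of the cell for the
REGULAR Taylor coefficients `[T^d]F_K`, `d > A`, of the brick kernels, and the Krattenthaler–Rivoal exponent `d − 1` for
`Σ_K [T^d]F_K(n)` at every odd prime (cell `pub-zeta5`, seat ct-1 g45)

HONEST FRAMING: systematic search; no irrationality claim unless certified.  `p`-ADIC BOOKKEEPING of the local power series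
`F_K(T) = T^A·R_n(T − K)` (`BrickLaurent.laurentSeries`) of the brick kernels
`R_n(t) = n!^{A−2B}(t + n/2)^ε ∏_{m=1}^{n}(t−m)^B ∏_{m=1}^{n}(t+n+m)^B / ∏_{m=0}^{n}(t+m)^A` at ALL depths `d` — the cells
`c_{K,s} = [T^{A−s}]F_K` (`d ≤ A`) AND the regular Taylor coefficients `a_{K,C} = [T^{A+C}]F_K` (`d > A`).  Nothing about the
arithmetic nature of `ζ(5)`/`ζ(3)`; no `γ` / `μ` / denominator-law / record statement; records in print UNMOVED.  Theorems only.

WHY.  zi-eng's PROPOSITION H^∞ (`BrickPropositionHInf.propositionH_inf`) is written for the cells, normalisation `p^{ℓ(A−s)}`,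
`s : ℕ`, hence for the depths `d = A − s ≤ A` only.  Its ingredients are DEPTH-DIAGONAL: the ° residue law
(`BrickResidueLawCirc.residueLaw_circ_depth`), the hole = hat comparison (`BrickLevelReductionInf.hole_cell_le`) and the centre
(`BrickLaurentValuation.laurent_centre`) take any `d`, and the block / hole WEIGHTS do not see `d` at all.  So the same induction
runs depth by depth with the normalisation `p^{ℓd}`; this file writes it out.  CONSUMER (ct-1 g45's `BrickRegularCoefficients`,
`BrickDenominatorsOddC`): for ODD `C`, Krattenthaler–Rivoal's constant term satisfies `2·p_{0,C,n}(1) = −Σ_m [T^{A+C}]F_m` (full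
kernel, `A` even), so THÉORÈME 1 (ii) of Mem. AMS 875 (2007) for odd `C` is the clause below at depth `d = A + C`.

## Statements (`p` odd prime, `2B ≤ A`; for H^∞: `A` even, `1 ≤ B`)

* `centre_laurent_le` — the exact centre of the full kernel at level `L+1`: `v(p^{(L+1)d}[T^d]F_{n/2}) ≤ exp(−(L+1))`.
* `level_reduction_inf_depth` — ONE-LEVEL REDUCTION at depth `d` (verbatim `BrickLevelReductionInf.level_reduction_inf` with
  `laurent … d` for `cell … s`): `v(Σ_k g(k)p^{(L+1)d}[T^d]F_k^{(n)} − Σ_K W(K)p^{Ld}[T^d]F̃_K^{(N)} − Σ_{K<N} G(K)p^{Ld}[T^d]F̃_K^{(N−1)})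
  ≤ exp(−(L+1))`, `n = n₀ + Np`, `W = blockWeight`, `G = holeWeight`.
* `level_step_inf_depth` — the induction step (pattern of `BrickPropositionHInf.level_step_inf`).
* **`propositionH_inf_depth`** — for EVERY `ℓ`, every `M < p^{ℓ+1}`, every admissible weight `g` ((I), (S_ℓ), (D)) and EVERY
  depth `d`: `v(Σ_{k≤M} g(k)·p^{ℓd}·[T^d]F̃_k^{(M)}) ≤ exp(−ℓ)` (centre-free kernel `ε = 0`).  At `d = A − s` this is the cells
  clause of `propositionH_inf`; for `d > A` it is new.
* **`level_const_depth`**, **`padicValuation_sum_laurent_le`**, **`padicValuation_lcmUpto_pow_mul_sum_laurent_le`** — the full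
  kernel `ε = 1` with the constant weight: `v(p^{Ld}Σ_K[T^d]F_K(n)) ≤ exp(−L)` (`n < p^{L+1}`), `ord_p Σ_K[T^d]F_K(n) ≥
  −⌊log_p n⌋(d−1)`, **`d_n^{d−1}·Σ_{K≤n}[T^d]F_K(n) ∈ ℤ_(p)`** (`1 ≤ d`) — one `⌊log_p n⌋` better than the termwise bound
  `ord_p [T^d]F_K ≥ −⌊log_p n⌋·d` (`BrickTopKummer.laurent_valuation_abs`); for `d = A − l` this is KR's clause (i).
DATA (seat desk `alg/laurent.py`, exact, not used by the kernel): the last bound holds with margin `0` at some odd `d > A` for every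
probed `(A,B) ∈ {(4,1),(6,1),(6,2),(8,3)}`, `p ∈ {3,5,7}`, `n ≤ 12`.
-/

namespace Summit.KontsevichZagierPeriods.Zeta5Search.BrickPropositionHDepth

open Finset Nat WithZero
open Summit.KontsevichZagierPeriods.Zeta5Search.BrickTopCoefficient (cTop)
open Summit.KontsevichZagierPeriods.Zeta5Search.BrickLaurent (laurent cell)
open Summit.KontsevichZagierPeriods.Zeta5Search.BrickLaurentValuation (laurent_centre)
open Summit.KontsevichZagierPeriods.Zeta5Search.BrickTopKummer (laurent_valuation_abs)
open Summit.KontsevichZagierPeriods.Zeta5Search.BrickLambda (cTop_zero_ne_zero)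
open Summit.KontsevichZagierPeriods.Zeta5Search.BrickLevelReduction (blockWeight cTop_one_centre sum_range_digit_split row_lt)
open Summit.KontsevichZagierPeriods.Zeta5Search.BrickBlockWeight (blockWeight_le blockWeight_reflect_add_le blockWeight_local)
open Summit.KontsevichZagierPeriods.Zeta5Search.BrickHoleWeight (holeWeight holeWeight_le holeWeight_reflect_add_le
  holeWeight_local)
open Summit.KontsevichZagierPeriods.Zeta5Search.BrickPropositionH (padicValuation_div_prime_le)
open Summit.KontsevichZagierPeriods.Zeta5Search.BrickPropositionHInf (padicValuation_div_pow_le)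
open Summit.KontsevichZagierPeriods.Zeta5Search.BrickResidueLawCirc (residueLaw_circ_depth)
open Summit.KontsevichZagierPeriods.Zeta5Search.BrickLevelReductionInf (hole_cell_le)
open Summit.KontsevichZagierPeriods.Zeta5Search.BrickDenominators (padicValuation_lcmUpto le_exp_of_pow_mul_le)

noncomputable section

variable {p : ℕ} [Fact p.Prime]

/-! ## The exact centre at depth `d` -/

/-- **The centre of the full kernel at level `L+1`, depth `d`** (`ε = 1`, `2k = n < p^{L+2}`):
`v(p^{(L+1)d}·[T^d]F_k) ≤ exp(−(L+1))` — `[T^{d}]F_k = [T^{d−1}]F̃_k` (`laurent_centre`), `[T^0]F_k = 0`. -/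
theorem centre_laurent_le (hp2 : p ≠ 2) {A B L n : ℕ} (hAB : 2 * B ≤ A) (hn : n < p ^ (L + 1 + 1)) {k : ℕ} (hk : k ≤ n)
    (hc : 2 * k = n) (d : ℕ) :
    Rat.padicValuation p ((p : ℚ) ^ ((L + 1) * d) * laurent A B 1 n k d) ≤ exp (-((L : ℤ) + 1)) := by
  rcases d with _ | d
  · rw [(laurent_centre A B hc 0).2, mul_zero, map_zero]; exact _root_.zero_le
  · rw [(laurent_centre A B hc d).1, map_mul, map_pow, Rat.padicValuation_self, ← exp_nsmul]
    refine (mul_le_mul' le_rfl (laurent_valuation_abs hp2 hAB (ε := 0) hn hk (Or.inr rfl) d)).trans ?_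
    rw [← exp_add, exp_le_exp, nsmul_eq_mul]
    push_cast
    nlinarith

/-! ## The one-level reduction at depth `d` -/

section reduction

variable (hp2 : p ≠ 2) {A B ε N n₀ L : ℕ} (hAB : 2 * B ≤ A) (hB : 1 ≤ B) (hε : ε ≤ 1) (hn₀ : n₀ < p)
  (hN : N < p ^ (L + 1)) {g : ℕ → ℚ} (hg : ∀ k, k ≤ n₀ + N * p → Rat.padicValuation p (g k) ≤ 1)
include hp2 hAB hB hε hn₀ hN hg

/-- **ONE-LEVEL REDUCTION WITHOUT LEVEL HYPOTHESIS, depth `d`**: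
`v(Σ_{k≤n} g(k)·p^{(L+1)d}[T^d]F_k^{(n)} − Σ_{K≤N} W(K)·p^{Ld}[T^d]F̃_K^{(N)} − Σ_{K<N} G(K)·p^{Ld}[T^d]F̃_K^{(N−1)}) ≤ exp(−(L+1))`
(`W = blockWeight`, `G = holeWeight … (N−1) g`): ° cells by `residueLaw_circ_depth`, the centre carries `λ = 0`, hole cells by
`hole_cell_le` — the proof of `BrickLevelReductionInf.level_reduction_inf` with `laurent … d` in place of `cell … s`. -/
theorem level_reduction_inf_depth (d : ℕ) :
    Rat.padicValuation p (∑ k ∈ range (n₀ + N * p + 1), g k * ((p : ℚ) ^ ((L + 1) * d) * laurent A B ε (n₀ + N * p) k d) -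
      ∑ K ∈ range (N + 1), blockWeight A B ε p n₀ N g K * ((p : ℚ) ^ (L * d) * laurent A B 0 N K d) -
      ∑ K ∈ range N, holeWeight A B ε p n₀ (N - 1) g K * ((p : ℚ) ^ (L * d) * laurent A B 0 (N - 1) K d)) ≤
      exp (-((L : ℤ) + 1)) := by
  have hp : p.Prime := Fact.out
  have hn := row_lt (L := L) hn₀ hN
  have hA1 : (A : ℤ) + L ≥ L + 1 := by omega
  set n := n₀ + N * p with hn_def
  rw [sum_range_digit_split (p := p) _ hn₀ N]
  have hcirc : ∑ k₀ ∈ range (n₀ + 1), ∑ K ∈ range (N + 1),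
      g (k₀ + K * p) * ((p : ℚ) ^ ((L + 1) * d) * laurent A B ε n (k₀ + K * p) d) -
      ∑ K ∈ range (N + 1), blockWeight A B ε p n₀ N g K * ((p : ℚ) ^ (L * d) * laurent A B 0 N K d) =
      ∑ k₀ ∈ range (n₀ + 1), ∑ K ∈ range (N + 1), g (k₀ + K * p) *
        ((p : ℚ) ^ ((L + 1) * d) * laurent A B ε n (k₀ + K * p) d -
          cTop A B ε n (k₀ + K * p) / cTop A B 0 N K * ((p : ℚ) ^ (L * d) * laurent A B 0 N K d)) := by
    simp only [blockWeight, ← hn_def, Finset.sum_mul, mul_sub, Finset.sum_sub_distrib]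
    rw [Finset.sum_comm (s := range (N + 1)) (t := range (n₀ + 1))]
    congr 1
    exact Finset.sum_congr rfl fun k₀ _ => Finset.sum_congr rfl fun K _ => by ring
  have hhole : ∑ k₀ ∈ Ico (n₀ + 1) p, ∑ K ∈ range N,
      g (k₀ + K * p) * ((p : ℚ) ^ ((L + 1) * d) * laurent A B ε n (k₀ + K * p) d) -
      ∑ K ∈ range N, holeWeight A B ε p n₀ (N - 1) g K * ((p : ℚ) ^ (L * d) * laurent A B 0 (N - 1) K d) =
      ∑ k₀ ∈ Ico (n₀ + 1) p, ∑ K ∈ range N, (g (k₀ + K * p) *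
        ((p : ℚ) ^ ((L + 1) * d) * laurent A B ε n (k₀ + K * p) d) - g (k₀ + K * p) *
          (cTop A B ε (n₀ + (N - 1 + 1) * p) (k₀ + K * p) / cTop A B 0 (N - 1) K) *
          ((p : ℚ) ^ (L * d) * laurent A B 0 (N - 1) K d)) := by
    simp only [holeWeight, Finset.sum_mul, Finset.sum_sub_distrib]
    rw [Finset.sum_comm (s := range N) (t := Ico (n₀ + 1) p)]
  rw [show ∀ a b c e : ℚ, a + b - c - e = (a - c) + (b - e) from fun a b c e => by ring, hcirc, hhole]
  refine Valuation.map_add_le _ (Valuation.map_sum_le _ fun k₀ hk₀ => Valuation.map_sum_le _ fun K hK => ?_)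
    (Valuation.map_sum_le _ fun k₀ hk₀ => Valuation.map_sum_le _ fun K hK => ?_)
  · -- a ° cell
    have hk₀' := mem_range.1 hk₀
    have hK' := mem_range.1 hK
    have hkn : k₀ + K * p ≤ n := by rw [hn_def]; nlinarith
    rw [map_mul]
    refine (mul_le_mul' (hg _ hkn) ?_).trans (by rw [one_mul])
    by_cases hc : 2 * (k₀ + K * p) ≠ n ∨ ε = 0
    · exact residueLaw_circ_depth hp2 hAB rfl rfl hN hn₀ (by omega) (by omega) hc
        (div_mul_cancel₀ _ (cTop_zero_ne_zero (by omega) A B)) d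
    · have hε1 : ε = 1 := by omega
      have hcen : 2 * (k₀ + K * p) = n := by by_contra h; exact hc (Or.inl h)
      subst hε1
      rw [cTop_one_centre A B hcen, zero_div, zero_mul, sub_zero]
      exact centre_laurent_le hp2 hAB hn hkn hcen d
  · -- a hole cell
    have hk₀' := mem_Ico.1 hk₀
    have hK' := mem_range.1 hK
    obtain ⟨m, rfl⟩ : ∃ m, N = m + 1 := ⟨N - 1, by omega⟩
    rw [Nat.add_sub_cancel] at *
    have hm : m < p ^ (L + 1) := by omega
    have hkn : k₀ + K * p ≤ n := by rw [hn_def]; nlinarith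
    by_cases hc : 2 * (k₀ + K * p) ≠ n ∨ ε = 0
    · exact (hole_cell_le hp2 hAB hε hn₀ hm (by omega) (by omega) hk₀'.2 hc (hg _ hkn) d).trans
        (exp_le_exp.2 (by omega))
    · have hε1 : ε = 1 := by omega
      have hcen : 2 * (k₀ + K * p) = n := by by_contra h; exact hc (Or.inl h)
      subst hε1
      rw [hn_def] at hcen
      rw [cTop_one_centre A B hcen, zero_div, mul_zero, zero_mul, sub_zero, map_mul]
      exact (mul_le_mul' (hg _ hkn) (centre_laurent_le hp2 hAB hn hkn hcen d)).trans (by rw [one_mul])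

end reduction

/-! ## The induction step at every depth -/

section step

variable (hp2 : p ≠ 2) {A B ε N n₀ L : ℕ} (hA : Even A) (hB : 1 ≤ B) (hAB : 2 * B ≤ A) (hε : ε ≤ 1)
  (hn₀ : n₀ < p) (hN : N < p ^ (L + 1)) {g : ℕ → ℚ}
  (hgI : ∀ k, k ≤ n₀ + N * p → Rat.padicValuation p (g k) ≤ 1)
  (hgS : ∀ k, k ≤ n₀ + N * p →
    Rat.padicValuation p (g (n₀ + N * p - k) + (-1) ^ ε * g k) ≤ exp (-((L : ℤ) + 1)))
  (hgD : ∀ e k k', 1 ≤ e → e ≤ L + 1 → k ≤ n₀ + N * p → k' ≤ n₀ + N * p → (p : ℤ) ^ e ∣ (k : ℤ) - k' →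
    Rat.padicValuation p (g k' - g k) ≤ exp (-(e : ℤ)))
  (IH : ∀ M, M < p ^ (L + 1) → ∀ g' : ℕ → ℚ, (∀ K, K ≤ M → Rat.padicValuation p (g' K) ≤ 1) →
    (∀ K, K ≤ M → Rat.padicValuation p (g' (M - K) + g' K) ≤ exp (-(L : ℤ))) →
    (∀ e K K', 1 ≤ e → e ≤ L → K ≤ M → K' ≤ M → (p : ℤ) ^ e ∣ (K : ℤ) - K' →
      Rat.padicValuation p (g' K' - g' K) ≤ exp (-(e : ℤ))) →
    ∀ d, Rat.padicValuation p (∑ K ∈ range (M + 1), g' K * ((p : ℚ) ^ (L * d) * laurent A B 0 M K d)) ≤ exp (-(L : ℤ)))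
include hp2 hA hB hAB hε hn₀ hN hgI hgS hgD IH

/-- **THE INDUCTION STEP AT EVERY DEPTH**: if the depth clauses hold at level `L` for every row `M < p^{L+1}` and every
admissible weight, then for the row `n = n₀ + Np` (kernel `ε ≤ 1`) and every `g` satisfying (I), (S_ε), (D) at level `L+1`:
`v(Σ_{k≤n} g(k)·p^{(L+1)d}[T^d]F_k^{(n)}) ≤ exp(−(L+1))` for every `d` — via `W = p·ω` on the row `N` and `G = p^A·γ` on the
row `N − 1` (the weight laws of `BrickBlockWeight` / `BrickHoleWeight`, which do not see `d`). -/
theorem level_step_inf_depth (d : ℕ) :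
    Rat.padicValuation p (∑ k ∈ range (n₀ + N * p + 1),
      g k * ((p : ℚ) ^ ((L + 1) * d) * laurent A B ε (n₀ + N * p) k d)) ≤ exp (-((L : ℤ) + 1)) := by
  have hp : p.Prime := Fact.out
  have hpQ : (p : ℚ) ≠ 0 := by exact_mod_cast hp.ne_zero
  have hpA : (p : ℚ) ^ A ≠ 0 := pow_ne_zero _ hpQ
  have hA2 : 2 ≤ A := by omega
  set W : ℕ → ℚ := blockWeight A B ε p n₀ N g with hW
  set ω : ℕ → ℚ := fun K => W K / p with hω
  -- `ω` is admissible for `N` at level `L` (verbatim from `BrickPropositionHInf.level_step_inf`)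
  have hωI : ∀ K, K ≤ N → Rat.padicValuation p (ω K) ≤ 1 := fun K hK => by
    have h := padicValuation_div_prime_le (p := p) (blockWeight_le hp2 hA hB hε hn₀ hgI hgS hgD hK)
    rwa [show (-1 : ℤ) + 1 = 0 by norm_num, exp_zero] at h
  have hωS : ∀ K, K ≤ N → Rat.padicValuation p (ω (N - K) + ω K) ≤ exp (-(L : ℤ)) := fun K hK => by
    rw [hω]
    simp only
    rw [← add_div]
    have h := padicValuation_div_prime_le (p := p)
      (blockWeight_reflect_add_le hp2 (B := B) hA hε hn₀ (L := L) hgS hK)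
    rwa [show -((L : ℤ) + 1) + 1 = -(L : ℤ) by ring] at h
  have hωD : ∀ e K K', 1 ≤ e → e ≤ L → K ≤ N → K' ≤ N → (p : ℤ) ^ e ∣ (K : ℤ) - K' →
      Rat.padicValuation p (ω K' - ω K) ≤ exp (-(e : ℤ)) := fun e K K' he heL hK hK' hdvd => by
    rw [hω]
    simp only
    rw [← sub_div]
    have h := padicValuation_div_prime_le (p := p)
      (blockWeight_local hp2 (B := B) (ε := ε) hA hn₀ (L := L) hgI hgD he heL hK hK' hdvd)
    rwa [show -((e : ℤ) + 1) + 1 = -(e : ℤ) by ring] at h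
  have IHω := IH N hN ω hωI hωS hωD
  have hWω : ∀ K, W K = (p : ℚ) * ω K := fun K => by rw [hω]; simp only; rw [mul_div_cancel₀ _ hpQ]
  have hpv : Rat.padicValuation p (p : ℚ) = exp (-1 : ℤ) := Rat.padicValuation_self p
  -- the hole weight `G = p^A·γ` on the row `N − 1`
  set G : ℕ → ℚ := holeWeight A B ε p n₀ (N - 1) g with hG
  set γ : ℕ → ℚ := fun K => G K / (p : ℚ) ^ A with hγ
  have hGγ : ∀ K, G K = (p : ℚ) ^ A * γ K := fun K => by rw [hγ]; simp only; rw [mul_div_cancel₀ _ hpA]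
  have hhole : Rat.padicValuation p (∑ K ∈ range N, G K * ((p : ℚ) ^ (L * d) * laurent A B 0 (N - 1) K d)) ≤
      exp (-((L : ℤ) + 1)) := by
    rcases N with _ | m
    · simp only [Finset.range_zero, Finset.sum_empty, map_zero]
      exact _root_.zero_le
    · rw [Nat.add_sub_cancel] at hG ⊢
      have hm : m < p ^ (L + 1) := by omega
      -- `γ` is admissible for `m` at level `L`
      have hγI : ∀ K, K ≤ m → Rat.padicValuation p (γ K) ≤ 1 := fun K hK => by
        have h := padicValuation_div_pow_le (p := p) A (holeWeight_le hp2 hA hAB hn₀ (ε := ε) hgI hK)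
        rw [neg_add_cancel, exp_zero] at h
        simpa only [hγ, hG] using h
      have hγS : ∀ K, K ≤ m → Rat.padicValuation p (γ (m - K) + γ K) ≤ exp (-(L : ℤ)) := fun K hK => by
        have h := padicValuation_div_pow_le (p := p) A
          (holeWeight_reflect_add_le hp2 hA hAB (ε := ε) hε hn₀ (L := L) hgS hK)
        have h' : Rat.padicValuation p ((G (m - K) + G K) / (p : ℚ) ^ A) ≤ exp (-(L : ℤ)) := by
          rw [hG]; exact h.trans (exp_le_exp.2 (by omega))
        simpa only [hγ, add_div] using h'
      have hγD : ∀ e K K', 1 ≤ e → e ≤ L → K ≤ m → K' ≤ m → (p : ℤ) ^ e ∣ (K : ℤ) - K' →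
          Rat.padicValuation p (γ K' - γ K) ≤ exp (-(e : ℤ)) := fun e K K' he heL hK hK' hdvd => by
        have h := padicValuation_div_pow_le (p := p) A
          (holeWeight_local hp2 hA hAB (ε := ε) hn₀ (L := L) hgI hgD he heL hK hK' hdvd)
        have h' : Rat.padicValuation p ((G K' - G K) / (p : ℚ) ^ A) ≤ exp (-(e : ℤ)) := by
          rw [hG]; exact h.trans (exp_le_exp.2 (by omega))
        simpa only [hγ, sub_div] using h'
      have Hd := IH m hm γ hγI hγS hγD d
      have hpvA : Rat.padicValuation p ((p : ℚ) ^ A) = exp (-(A : ℤ)) := by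
        rw [map_pow, hpv, ← exp_nsmul, nsmul_eq_mul, mul_neg_one]
      rw [show ∑ K ∈ range (m + 1), G K * ((p : ℚ) ^ (L * d) * laurent A B 0 m K d) =
        (p : ℚ) ^ A * ∑ K ∈ range (m + 1), γ K * ((p : ℚ) ^ (L * d) * laurent A B 0 m K d) by
          rw [Finset.mul_sum]; exact Finset.sum_congr rfl fun K _ => by rw [hGγ K]; ring, map_mul, hpvA]
      calc _ ≤ exp (-(A : ℤ)) * exp (-(L : ℤ)) := mul_le_mul' le_rfl Hd
        _ ≤ _ := by rw [← exp_add, exp_le_exp]; omega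
  have hred := level_reduction_inf_depth hp2 hAB hB hε hn₀ hN hgI d
  have hmain : Rat.padicValuation p (∑ K ∈ range (N + 1),
      blockWeight A B ε p n₀ N g K * ((p : ℚ) ^ (L * d) * laurent A B 0 N K d)) ≤ exp (-((L : ℤ) + 1)) := by
    rw [← hW, show ∑ K ∈ range (N + 1), W K * ((p : ℚ) ^ (L * d) * laurent A B 0 N K d) =
      (p : ℚ) * ∑ K ∈ range (N + 1), ω K * ((p : ℚ) ^ (L * d) * laurent A B 0 N K d) by
        rw [Finset.mul_sum]; exact Finset.sum_congr rfl fun K _ => by rw [hWω K]; ring, map_mul, hpv]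
    calc _ ≤ exp (-1 : ℤ) * exp (-(L : ℤ)) := mul_le_mul' le_rfl (IHω d)
      _ = _ := by rw [← exp_add]; congr 1; ring
  rw [← hG] at hred
  have h := Valuation.map_add_le _ (Valuation.map_add_le _ hred hhole) hmain
  rwa [sub_add_cancel, sub_add_cancel] at h

end step

/-! ## PROPOSITION H^∞ at every depth -/

/-- **Level `0`, every depth**: for `M < p` and `g ∈ ℤ_(p)`, `v(Σ_{k≤M} g(k)·[T^d]F̃_k^{(M)}) ≤ 1` — one-digit integrality of the
local series (`BrickTopKummer.laurent_valuation_abs` at `L = 0`). -/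
theorem level_zero_depth (hp2 : p ≠ 2) {A B : ℕ} (hAB : 2 * B ≤ A) {M : ℕ} (hM : M < p ^ (0 + 1)) {g : ℕ → ℚ}
    (hgI : ∀ k, k ≤ M → Rat.padicValuation p (g k) ≤ 1) (d : ℕ) :
    Rat.padicValuation p (∑ k ∈ range (M + 1), g k * ((p : ℚ) ^ (0 * d) * laurent A B 0 M k d)) ≤ exp (-((0 : ℕ) : ℤ)) := by
  rw [Nat.cast_zero, neg_zero, exp_zero]
  refine Valuation.map_sum_le _ fun k hk => ?_
  have hk' : k ≤ M := by have := mem_range.1 hk; omega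
  rw [zero_mul, pow_zero, one_mul, map_mul]
  have h := laurent_valuation_abs hp2 hAB (L := 0) (ε := 0) hM hk' (Or.inr rfl) d
  rw [Nat.cast_zero, zero_mul, exp_zero] at h
  exact mul_le_one' (hgI k hk') h

/-- **PROPOSITION H^∞ AT EVERY DEPTH** (odd prime `p`, `A` even, `1 ≤ B`, `2B ≤ A`): for EVERY level `ℓ`, every row
`M < p^{ℓ+1}` of the centre-free kernel, every admissible weight `g` ((I) `g ∈ ℤ_(p)`, (S_ℓ) `g(M−k) + g(k) ≡ 0 (mod p^ℓ)`,
(D) digit-locality) and EVERY depth `d`: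
`v(Σ_{k≤M} g(k)·p^{ℓd}·[T^d]F̃_k^{(M)}) ≤ exp(−ℓ)`.
For `d = A − s` this is the cells clause of zi-eng's `BrickPropositionHInf.propositionH_inf`; for `d > A` (the regular Taylor
coefficients of `R̃_M` at its poles) it is new. -/
theorem propositionH_inf_depth (hp2 : p ≠ 2) {A B : ℕ} (hA : Even A) (hB : 1 ≤ B) (hAB : 2 * B ≤ A) :
    ∀ ℓ : ℕ, ∀ M : ℕ, M < p ^ (ℓ + 1) → ∀ g : ℕ → ℚ, (∀ k, k ≤ M → Rat.padicValuation p (g k) ≤ 1) →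
      (∀ k, k ≤ M → Rat.padicValuation p (g (M - k) + g k) ≤ exp (-(ℓ : ℤ))) →
      (∀ e k k', 1 ≤ e → e ≤ ℓ → k ≤ M → k' ≤ M → (p : ℤ) ^ e ∣ (k : ℤ) - k' →
        Rat.padicValuation p (g k' - g k) ≤ exp (-(e : ℤ))) →
      ∀ d, Rat.padicValuation p (∑ k ∈ range (M + 1), g k * ((p : ℚ) ^ (ℓ * d) * laurent A B 0 M k d)) ≤
        exp (-(ℓ : ℤ)) := by
  have hp : p.Prime := Fact.out
  intro ℓ
  induction ℓ with
  | zero =>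
    intro M hM g hgI _ _ d
    exact level_zero_depth hp2 hAB hM hgI d
  | succ L ih =>
    intro M hM g hgI hgS hgD d
    obtain ⟨n₀, N, hn₀, rfl⟩ : ∃ n₀ N, n₀ < p ∧ M = n₀ + N * p :=
      ⟨M % p, M / p, Nat.mod_lt _ hp.pos, (Nat.mod_add_div' M p).symm⟩
    have hN : N < p ^ (L + 1) := by
      rw [Nat.lt_iff_add_one_le]
      by_contra h
      have h' : p ^ (L + 1) ≤ N := by omega
      have : p ^ (L + 1 + 1) ≤ n₀ + N * p := by
        calc p ^ (L + 1 + 1) = p ^ (L + 1) * p := pow_succ _ _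
          _ ≤ N * p := Nat.mul_le_mul_right _ h'
          _ ≤ n₀ + N * p := Nat.le_add_left _ _
      omega
    have hgS' : ∀ k, k ≤ n₀ + N * p →
        Rat.padicValuation p (g (n₀ + N * p - k) + (-1) ^ 0 * g k) ≤ exp (-((L : ℤ) + 1)) := fun k hk => by
      rw [pow_zero, one_mul]; exact_mod_cast hgS k hk
    have h := level_step_inf_depth hp2 hA hB hAB (ε := 0) (Nat.zero_le 1) hn₀ hN hgI hgS'
      (fun e k k' he heL hk hk' hdvd => hgD e k k' he (by omega) hk hk' hdvd)
      (fun M' hM' g' h1 h2 h3 => ih M' hM' g' h1 h2 h3) d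
    exact_mod_cast h

/-! ## The full kernel with the constant weight: the exponent `d − 1` at every odd prime -/

section const

variable (hp2 : p ≠ 2) {A B : ℕ} (hA : Even A) (hB : 1 ≤ B) (hAB : 2 * B ≤ A)
include hp2 hA hB hAB

/-- **H^∞ at every depth, constant weight** (odd `p`, `A` even, `1 ≤ B`, `2B ≤ A`; EVERY level `L`, row `n < p^{L+1}` of the full
kernel `ε = 1`): `v(p^{Ld}·Σ_{K≤n}[T^d]F_K(n)) ≤ exp(−L)` for every depth `d` — `level_step_inf_depth` with `g ≡ 1` ((I), (S_1)
`g(n−k) − g(k) = 0`, (D) trivially), the lower rows by `propositionH_inf_depth`; level `0` is one-digit integrality. -/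
theorem level_const_depth {L n : ℕ} (hn : n < p ^ (L + 1)) (d : ℕ) :
    Rat.padicValuation p ((p : ℚ) ^ (L * d) * ∑ K ∈ range (n + 1), laurent A B 1 n K d) ≤ exp (-(L : ℤ)) := by
  have hp : p.Prime := Fact.out
  rcases L with _ | L
  · rw [Nat.cast_zero, neg_zero, exp_zero, zero_mul, pow_zero, one_mul]
    refine Valuation.map_sum_le _ fun K hK => ?_
    have hK' : K ≤ n := by have := mem_range.1 hK; omega
    by_cases hc : 2 * K = n
    · rcases d with _ | d
      · rw [(laurent_centre A B hc 0).2, map_zero]; exact _root_.zero_le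
      · rw [(laurent_centre A B hc d).1]
        have h := laurent_valuation_abs hp2 hAB (L := 0) (ε := 0) hn hK' (Or.inr rfl) d
        rwa [Nat.cast_zero, zero_mul, exp_zero] at h
    · have h := laurent_valuation_abs hp2 hAB (L := 0) (ε := 1) hn hK' (Or.inl hc) d
      rwa [Nat.cast_zero, zero_mul, exp_zero] at h
  · obtain ⟨n₀, N, hn₀, rfl⟩ : ∃ n₀ N, n₀ < p ∧ n = n₀ + N * p :=
      ⟨n % p, n / p, Nat.mod_lt _ hp.pos, (Nat.mod_add_div' n p).symm⟩
    have hN : N < p ^ (L + 1) := by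
      rw [Nat.lt_iff_add_one_le]
      by_contra h
      have h' : p ^ (L + 1) ≤ N := by omega
      have : p ^ (L + 1 + 1) ≤ n₀ + N * p := by
        calc p ^ (L + 1 + 1) = p ^ (L + 1) * p := pow_succ _ _
          _ ≤ N * p := Nat.mul_le_mul_right _ h'
          _ ≤ n₀ + N * p := Nat.le_add_left _ _
      omega
    have h := level_step_inf_depth hp2 hA hB hAB (ε := 1) le_rfl hn₀ hN (g := fun _ : ℕ => (1 : ℚ))
      (fun k _ => (map_one _).le) (fun k _ => ?_) (fun e k k' _ _ _ _ _ => ?_)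
      (fun M' hM' g' h1 h2 h3 => propositionH_inf_depth hp2 hA hB hAB L M' hM' g' h1 h2 h3) d
    · simp only [one_mul, ← Finset.mul_sum] at h
      exact_mod_cast h
    · rw [pow_one, neg_one_mul, add_neg_cancel, map_zero]
      exact _root_.zero_le
    · rw [sub_self, map_zero]
      exact _root_.zero_le

/-- **`ord_p Σ_{K≤n}[T^d]F_K(n) ≥ −⌊log_p n⌋·(d − 1)`** for every odd prime `p`, every `n` and EVERY depth `d` (full kernel
`(A,B,1)`, `A` even, `1 ≤ B ≤ A/2`): `v(Σ_K [T^d]F_K(n)) ≤ exp(⌊log_p n⌋·(d−1))` — one `⌊log_p n⌋` better than termwise.  For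
`d = A − s` this is `BrickDenominators.padicValuation_xCoeff_le` (KR's clause (i)); for `d = A + C` it is the saving that
KR's clause (ii) needs for odd `C` (ct-1 g45's `BrickDenominatorsOddC`). -/
theorem padicValuation_sum_laurent_le (n d : ℕ) :
    Rat.padicValuation p (∑ K ∈ range (n + 1), laurent A B 1 n K d) ≤ exp ((Nat.log p n : ℤ) * ((d : ℤ) - 1)) := by
  have hp : p.Prime := Fact.out
  have hn : n < p ^ (Nat.log p n + 1) := Nat.lt_pow_succ_log_self hp.one_lt n
  refine (le_exp_of_pow_mul_le (level_const_depth hp2 hA hB hAB hn d)).trans (exp_le_exp.2 ?_)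
  push_cast
  nlinarith

/-- **`d_n^{d−1}·Σ_{K≤n}[T^d]F_K(n) ∈ ℤ_(p)`** for every odd prime `p`, every `n` and every depth `d ≥ 1` (`d_n = lcm(1,…,n)`;
full kernel `(A,B,1)`, `A` even, `1 ≤ B ≤ A/2`).  At `d = A − l` (`1 ≤ l ≤ A−1`) this is Krattenthaler–Rivoal's Théorème 1 (i)
at `p` (`BrickDenominators`); at `d = A + C`, `C` odd, it is their Théorème 1 (ii) at `p` (see `BrickDenominatorsOddC`). -/
theorem padicValuation_lcmUpto_pow_mul_sum_laurent_le (n : ℕ) {d : ℕ} (hd : 1 ≤ d) :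
    Rat.padicValuation p (((Nat.lcmUpto n : ℕ) : ℚ) ^ (d - 1) * ∑ K ∈ range (n + 1), laurent A B 1 n K d) ≤ 1 := by
  rw [map_mul, map_pow, padicValuation_lcmUpto, ← exp_nsmul, nsmul_eq_mul]
  refine (mul_le_mul' le_rfl (padicValuation_sum_laurent_le hp2 hA hB hAB n d)).trans ?_
  rw [← exp_add, ← exp_zero, exp_le_exp]
  push_cast [Nat.cast_sub hd]
  nlinarith

end const

end

end Summit.KontsevichZagierPeriods.Zeta5Search.BrickPropositionHDepth
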